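import Literature.Probability.RandomPlanarGeometry.HexSAWStripBridgeKernelResidue
import HarnessLib

/-!
# Critical irreducible bridges of the honeycomb strip have a finite mean number of surface contacts

Topic `Literature/Probability/RandomPlanarGeometry` (continues `HexSAWStripBridgeKernelResidue.lean`; same sources).  Lane «pcv-sawmu»
(human-funded CriticalPhenomena venture), a-p2 g18 (§1–§2) / g19 (§3).  Sources for the OBJECTS: Duminil-Copin–Hammond, CMP 324 (2013)
§2.2 (bridges, renewal points, irreducible bridges); Beaton–Bousquet-Mélou–de Gier–Duminil-Copin–Guttmann, CMP 326 (2014),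
arXiv:1109.0358v5, §3.2 and Corollary 8 (the surface threshold `y_T` of the strip `S_T`); Seneta (1973) Chapter 6 (R-theory of
non-negative matrices: finiteness at the convergence parameter).  The statements below are the lane's; nothing of the kind is printed
for the strip.

## What is proved (namespace `Literature.Probability.RandomPlanarGeometry.SAW.HV`)

* §1 `irCoeffN T N j a b` / `irCoeff T j a b = m_{ab}(j)`: the `x_c`-weighted number of irreducible standard horizontal bridges of
  `S_T` from level `a` to level `b` with exactly `j` surface contacts off the start vertex; `Imat_eq_sum_irCoeffN` (the truncated
  kernel is a polynomial in `y` with these non-negative coefficients).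
* §2 ★★ `Iinf_eq_tsum_irCoeff` (`1 ≤ T`): `I(y)_{ab} = Σ_j m_{ab}(j) y^j` on `[1, y_T)`.
* §3 (`2 ≤ T`, from the endpoint-Lipschitz bound `NeumannFamily.sub_le_mul_sub` of `Literature.Analysis.Matrix.NonnegMatrixFamilyResidue`
  applied to the family `exists_neumannFamily_Iinf` of `HexSAWStripBridgeKernelResidue`):
  ★★ `exists_sum_irCoeff_stripYT_sub_le` — `Σ_{j<M} m_{ab}(j) (y_T^j − y^j) ≤ K (y_T − y)` near `y_T`;
  ★★★ `summable_irCoeff_mul_pow_stripYT` + `tendsto_Iinf_tsum_irCoeff_stripYT` — the coefficient series CONVERGES AT the threshold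
  and `I(y)_{ab} → Σ_j m_{ab}(j) y_T^j` as `y ↑ y_T` (the limit kernel `I_T` of the residue theorem is the kernel AT `y_T`);
  ★★★ `exists_tsum_mul_irCoeff_mul_pow_le` — **`Σ_j j · m_{ab}(j) · y_T^{j−1} ≤ K < ∞`: the mean number of surface contacts of a
  critical irreducible bridge is finite** (the «finite mean renewal time» of the strip's renewal structure at `y_T`).

* §4 (tree notions only) ★★ `exists_Iinf_sub_Iinf_le_mul` — `I(·)_{ab}` is Lipschitz on a left neighbourhood of `y_T`;
  ★★ `exists_kernelLimit_sub_Iinf_le` — a limit kernel `I_T` with `0 ≤ (I_T − I(y))_{ab} ≤ K (y_T − y)` (linear rate at the threshold).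

NOT claimed: the value of the mean, `T = 1`, anything uniform in `T`, the coefficientwise renewal theorem (separate file).
-/

noncomputable section

open Finset Filter Topology Matrix Literature.Probability.LatticeModels Literature.Probability.Percolation Literature.Analysis.Matrix

namespace Literature.Probability.RandomPlanarGeometry.SAW

namespace HV

variable {T : ℕ}

/-! ### §1 The contact coefficients of the irreducible-bridge kernel -/

/-- `m^{(N)}_{ab}(j) = Σ x_c^{|h|−1}` over the IRREDUCIBLE standard horizontal bridges `a → b` with at most `N + 1` vertices and exactly
`j` surface contacts off the start vertex: the coefficient of `y^j` in `Imat T N y a b`. [cite: DuminilCopinHammond2013, §2.2 (irreducible bridges); BeatonBousquetMelouDeGierDuminilCopinGuttmann2014, §3.2] -/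
def irCoeffN (T N j : ℕ) (a b : ℤ) : ℝ :=
  ∑ l ∈ (HBk T N 1 a b).filter (fun l => topCnt T l.tail = j), hexCriticalFugacity ^ (l.length - 1)

/-- `m^{(N)}_{ab}(j) ≥ 0`. [cite: DuminilCopinHammond2013, §2.2; lane plumbing] -/
theorem irCoeffN_nonneg (T N j : ℕ) (a b : ℤ) : 0 ≤ irCoeffN T N j a b :=
  sum_nonneg fun _ _ => pow_nonneg hexCriticalFugacity_pos_lt_one.1.le _

/-- An irreducible bridge with at most `N + 1` vertices has at most `N` contacts off its start vertex (plumbing).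
[cite: DuminilCopinHammond2013, §2.2; lane plumbing] -/
theorem topCnt_tail_le_of_mem_HBk {N k : ℕ} {a b : ℤ} {l : List HV} (hl : l ∈ HBk T N k a b) : topCnt T l.tail ≤ N := by
  rw [HBk, mem_filter, mem_hBridgesN_iff] at hl
  have h1 : topCnt T l.tail ≤ l.tail.length := List.length_filter_le _ _
  have h2 : l.tail.length ≤ N := by rw [List.length_tail]; omega
  exact h1.trans h2

/-- ★ `Imat T N y a b = Σ_{j ≤ N} m^{(N)}_{ab}(j) · y^j`: the truncated irreducible kernel is a polynomial in `y` with non-negative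
coefficients. [cite: BeatonBousquetMelouDeGierDuminilCopinGuttmann2014, §3.2; DuminilCopinHammond2013, §2.2; lane plumbing] -/
theorem Imat_eq_sum_irCoeffN (T N : ℕ) (y : ℝ) (a b : Fin (2 * T)) :
    Imat T N y a b = ∑ j ∈ range (N + 1), irCoeffN T N j (a : ℕ) (b : ℕ) * y ^ j := by
  classical
  rw [Imat, Dk]
  have hmaps : ∀ l ∈ HBk T N 1 (a : ℕ) (b : ℕ), topCnt T l.tail ∈ range (N + 1) := fun l hl =>
    mem_range.2 (Nat.lt_succ_of_le (topCnt_tail_le_of_mem_HBk hl))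
  rw [← sum_fiberwise_of_maps_to hmaps]
  refine sum_congr rfl fun j _ => ?_
  rw [irCoeffN, sum_mul]
  refine sum_congr rfl fun l hl => ?_
  rw [mem_filter] at hl
  rw [wD, hl.2]

/-- The coefficients grow with the vertex bound. [cite: DuminilCopinHammond2013, §2.2; lane plumbing] -/
theorem irCoeffN_mono {N N' : ℕ} (h : N ≤ N') (j : ℕ) (a b : ℤ) : irCoeffN T N j a b ≤ irCoeffN T N' j a b := by
  classical
  refine sum_le_sum_of_subset_of_nonneg (fun l hl => ?_) fun _ _ _ => pow_nonneg hexCriticalFugacity_pos_lt_one.1.le _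
  rw [mem_filter] at hl ⊢
  exact ⟨HBk_mono h 1 a b hl.1, hl.2⟩

/-- `m^{(N)}_{ab}(j) ≤ Imat T N 1 a b ≤ I(1)_{ab}`: the coefficients are bounded. [cite: BeatonBousquetMelouDeGierDuminilCopinGuttmann2014, Corollary 8 (y_T > 1); lane plumbing] -/
theorem irCoeffN_le_Iinf_one (hT : 1 ≤ T) (N j : ℕ) (a b : Fin (2 * T)) :
    irCoeffN T N j (a : ℕ) (b : ℕ) ≤ Iinf T 1 a b := by
  have h1mem : (1 : ℝ) ∈ Set.Ico (1 : ℝ) (stripYT T) := ⟨le_rfl, one_lt_stripYT hT⟩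
  have hle : irCoeffN T N j (a : ℕ) (b : ℕ) ≤ Imat T N 1 a b := by
    rw [Imat_eq_sum_irCoeffN]
    simp only [one_pow, mul_one]
    by_cases hj : j ∈ range (N + 1)
    · exact single_le_sum (f := fun j => irCoeffN T N j (a : ℕ) (b : ℕ)) (fun i _ => irCoeffN_nonneg T N i _ _) hj
    · have h0 : irCoeffN T N j (a : ℕ) (b : ℕ) = 0 := by
        rw [irCoeffN]
        refine sum_eq_zero fun l hl => ?_
        rw [mem_filter] at hl
        exact absurd (mem_range.2 (Nat.lt_succ_of_le (hl.2 ▸ topCnt_tail_le_of_mem_HBk hl.1))) hj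
      rw [h0]
      exact sum_nonneg fun i _ => irCoeffN_nonneg T N i _ _
  exact hle.trans (Imat_le_Iinf hT h1mem N a b)

/-- ★ **The contact coefficients of the irreducible kernel** `m_{ab}(j) = sup_N m^{(N)}_{ab}(j)`: the `x_c`-weighted number of
irreducible standard horizontal bridges of `S_T` from level `a` to level `b` with exactly `j` surface contacts off the start vertex.
[cite: DuminilCopinHammond2013, §2.2; BeatonBousquetMelouDeGierDuminilCopinGuttmann2014, §3.2] -/
def irCoeff (T j : ℕ) (a b : Fin (2 * T)) : ℝ := ⨆ N : ℕ, irCoeffN T N j (a : ℕ) (b : ℕ)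

/-- `BddAbove` of the truncated coefficients. [cite: DuminilCopinHammond2013, §2.2; lane plumbing] -/
theorem bddAbove_irCoeffN (hT : 1 ≤ T) (j : ℕ) (a b : Fin (2 * T)) :
    BddAbove (Set.range fun N : ℕ => irCoeffN T N j (a : ℕ) (b : ℕ)) :=
  ⟨Iinf T 1 a b, by rintro _ ⟨N, rfl⟩; exact irCoeffN_le_Iinf_one hT N j a b⟩

/-- `m^{(N)}_{ab}(j) ≤ m_{ab}(j)`. [cite: DuminilCopinHammond2013, §2.2; lane plumbing] -/
theorem irCoeffN_le_irCoeff (hT : 1 ≤ T) (N j : ℕ) (a b : Fin (2 * T)) : irCoeffN T N j (a : ℕ) (b : ℕ) ≤ irCoeff T j a b :=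
  le_ciSup (bddAbove_irCoeffN hT j a b) N

/-- `0 ≤ m_{ab}(j)`. [cite: DuminilCopinHammond2013, §2.2; lane plumbing] -/
theorem irCoeff_nonneg (hT : 1 ≤ T) (j : ℕ) (a b : Fin (2 * T)) : 0 ≤ irCoeff T j a b :=
  (irCoeffN_nonneg T 0 j _ _).trans (irCoeffN_le_irCoeff hT 0 j a b)

/-- `m^{(N)}_{ab}(j) → m_{ab}(j)` (monotone convergence). [cite: DuminilCopinHammond2013, §2.2; lane plumbing] -/
theorem tendsto_irCoeffN (hT : 1 ≤ T) (j : ℕ) (a b : Fin (2 * T)) :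
    Tendsto (fun N => irCoeffN T N j (a : ℕ) (b : ℕ)) atTop (𝓝 (irCoeff T j a b)) :=
  tendsto_atTop_ciSup (fun _ _ h => irCoeffN_mono h j _ _) (bddAbove_irCoeffN hT j a b)

/-! ### §2 `I(y)_{ab} = Σ_j m_{ab}(j) y^j` on `[1, y_T)` -/

/-- Finite sums of the coefficient series stay below `I(y)_{ab}`. [cite: DuminilCopinHammond2013, §2.2; lane plumbing] -/
theorem sum_range_irCoeff_mul_pow_le (hT : 1 ≤ T) {y : ℝ} (hy : y ∈ Set.Ico 1 (stripYT T)) (a b : Fin (2 * T)) (M : ℕ) :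
    ∑ j ∈ range M, irCoeff T j a b * y ^ j ≤ Iinf T y a b := by
  have hy0 : 0 ≤ y := zero_le_one.trans hy.1
  have hlim : Tendsto (fun N => ∑ j ∈ range M, irCoeffN T N j (a : ℕ) (b : ℕ) * y ^ j) atTop
      (𝓝 (∑ j ∈ range M, irCoeff T j a b * y ^ j)) :=
    tendsto_finsetSum _ fun j _ => (tendsto_irCoeffN hT j a b).mul_const _
  refine le_of_tendsto hlim ?_
  filter_upwards [eventually_ge_atTop M] with N hN
  calc ∑ j ∈ range M, irCoeffN T N j (a : ℕ) (b : ℕ) * y ^ j ≤ ∑ j ∈ range (N + 1), irCoeffN T N j (a : ℕ) (b : ℕ) * y ^ j :=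
        sum_le_sum_of_subset_of_nonneg (range_mono (by omega)) fun j _ _ => mul_nonneg (irCoeffN_nonneg T N j _ _) (pow_nonneg hy0 _)
    _ = Imat T N y a b := (Imat_eq_sum_irCoeffN T N y a b).symm
    _ ≤ Iinf T y a b := Imat_le_Iinf hT hy N a b

/-- The coefficient series of the kernel is summable on `[1, y_T)`. [cite: BeatonBousquetMelouDeGierDuminilCopinGuttmann2014, Corollary 8; lane plumbing] -/
theorem summable_irCoeff_mul_pow (hT : 1 ≤ T) {y : ℝ} (hy : y ∈ Set.Ico 1 (stripYT T)) (a b : Fin (2 * T)) :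
    Summable fun j => irCoeff T j a b * y ^ j :=
  summable_of_sum_range_le (fun j => mul_nonneg (irCoeff_nonneg hT j a b) (pow_nonneg (zero_le_one.trans hy.1) _))
    (sum_range_irCoeff_mul_pow_le hT hy a b)

/-- ★★ **`I(y)_{ab} = Σ_j m_{ab}(j) y^j` for `y ∈ [1, y_T)`** — the kernel of irreducible bridges is a power series in the surface
fugacity with the non-negative coefficients `irCoeff`. [cite: BeatonBousquetMelouDeGierDuminilCopinGuttmann2014, §3.2 and Corollary 8; DuminilCopinHammond2013, §2.2] -/
theorem Iinf_eq_tsum_irCoeff (hT : 1 ≤ T) {y : ℝ} (hy : y ∈ Set.Ico 1 (stripYT T)) (a b : Fin (2 * T)) :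
    Iinf T y a b = ∑' j, irCoeff T j a b * y ^ j := by
  have hy0 : 0 ≤ y := zero_le_one.trans hy.1
  have hsum := summable_irCoeff_mul_pow hT hy a b
  refine le_antisymm (ciSup_le fun N => ?_) (hsum.tsum_le_of_sum_range_le (sum_range_irCoeff_mul_pow_le hT hy a b))
  calc Imat T N y a b = ∑ j ∈ range (N + 1), irCoeffN T N j (a : ℕ) (b : ℕ) * y ^ j := Imat_eq_sum_irCoeffN T N y a b
    _ ≤ ∑ j ∈ range (N + 1), irCoeff T j a b * y ^ j :=
        sum_le_sum fun j _ => mul_le_mul_of_nonneg_right (irCoeffN_le_irCoeff hT N j a b) (pow_nonneg hy0 _)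
    _ ≤ ∑' j, irCoeff T j a b * y ^ j := hsum.sum_le_tsum _ fun j _ => mul_nonneg (irCoeff_nonneg hT j a b) (pow_nonneg hy0 _)

/-! ### §3 At the threshold (`2 ≤ T`): the coefficient series converges, and the mean contact number is finite -/

/-- `j · y^{j−1} · (y' − y) ≤ y'^j − y^j` for `0 ≤ y ≤ y'` (plumbing: the chord of `t ↦ t^j` above its left tangent).
[cite: Seneta1973, §6.2; lane plumbing] -/
private theorem mul_pow_mul_sub_le_pow_sub {y y' : ℝ} (hy : 0 ≤ y) (hyy : y ≤ y') (j : ℕ) :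
    (j : ℝ) * y ^ (j - 1) * (y' - y) ≤ y' ^ j - y ^ j := by
  have hgeom : (∑ i ∈ range j, y' ^ i * y ^ (j - 1 - i)) * (y' - y) = y' ^ j - y ^ j := Commute.geom_sum₂_mul (Commute.all _ _) j
  rw [← hgeom]
  refine mul_le_mul_of_nonneg_right ?_ (sub_nonneg.2 hyy)
  have hterm : ∀ i ∈ range j, y ^ (j - 1) ≤ y' ^ i * y ^ (j - 1 - i) := fun i hi => by
    have hij : i ≤ j - 1 := by have := mem_range.1 hi; omega
    calc y ^ (j - 1) = y ^ i * y ^ (j - 1 - i) := by rw [← pow_add]; congr 1; omega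
      _ ≤ y' ^ i * y ^ (j - 1 - i) := mul_le_mul_of_nonneg_right (pow_le_pow_left₀ hy hyy i) (pow_nonneg hy _)
  calc (j : ℝ) * y ^ (j - 1) = ∑ _i ∈ range j, y ^ (j - 1) := by rw [sum_const, card_range, nsmul_eq_mul]
    _ ≤ ∑ i ∈ range j, y' ^ i * y ^ (j - 1 - i) := sum_le_sum hterm

/-- The finite sums `Σ_{j<M} m_{ab}(j) (y'^j − y^j)` are below the increment `I(y')_{ab} − I(y)_{ab}` (`1 ≤ y ≤ y' < y_T`).
[cite: DuminilCopinHammond2013, §2.2; lane plumbing] -/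
theorem sum_irCoeff_mul_pow_sub_le (hT : 1 ≤ T) {y y' : ℝ} (hy : y ∈ Set.Ico 1 (stripYT T)) (hy' : y' ∈ Set.Ico 1 (stripYT T))
    (hyy : y ≤ y') (a b : Fin (2 * T)) (M : ℕ) :
    ∑ j ∈ range M, irCoeff T j a b * (y' ^ j - y ^ j) ≤ Iinf T y' a b - Iinf T y a b := by
  have hy0 : 0 ≤ y := zero_le_one.trans hy.1
  have hs := summable_irCoeff_mul_pow hT hy a b
  have hs' := summable_irCoeff_mul_pow hT hy' a b
  have hnn : ∀ j, 0 ≤ irCoeff T j a b * (y' ^ j - y ^ j) := fun j =>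
    mul_nonneg (irCoeff_nonneg hT j a b) (sub_nonneg.2 (pow_le_pow_left₀ hy0 hyy j))
  have hsub : Summable fun j => irCoeff T j a b * (y' ^ j - y ^ j) := by
    have : (fun j => irCoeff T j a b * (y' ^ j - y ^ j)) = fun j => irCoeff T j a b * y' ^ j - irCoeff T j a b * y ^ j := by
      funext j; ring
    rw [this]; exact hs'.sub hs
  calc ∑ j ∈ range M, irCoeff T j a b * (y' ^ j - y ^ j) ≤ ∑' j, irCoeff T j a b * (y' ^ j - y ^ j) :=
        hsub.sum_le_tsum _ fun j _ => hnn j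
    _ = ∑' j, irCoeff T j a b * y' ^ j - ∑' j, irCoeff T j a b * y ^ j := by
        rw [← hs'.tsum_sub hs]; exact tsum_congr fun j => by ring
    _ = Iinf T y' a b - Iinf T y a b := by rw [← Iinf_eq_tsum_irCoeff hT hy, ← Iinf_eq_tsum_irCoeff hT hy']

/-- ★★ **Endpoint bound on the coefficient series.** For `T ≥ 2` there are `y₁ ∈ [1, y_T)` and `K` with
`Σ_{j<M} m_{ab}(j) · (y_T^j − y^j) ≤ K · (y_T − y)` for every `y ∈ [y₁, y_T)`, all levels `a, b` and all `M`
(the endpoint-Lipschitz bound of the residue theory, `NeumannFamily.sub_le_mul_sub`, read on the power series of §2 and pushed to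
`y' = y_T` in each finite sum). [cite: Seneta1973, §6.2 Theorem 6.3 (finiteness at the convergence parameter); DuminilCopinHammond2013, §2.2; BeatonBousquetMelouDeGierDuminilCopinGuttmann2014, Corollary 8; lane «pcv-sawmu» a-p2 g19] -/
theorem exists_sum_irCoeff_stripYT_sub_le (hT : 2 ≤ T) :
    ∃ y₁ ∈ Set.Ico (1 : ℝ) (stripYT T), ∃ K : ℝ, 0 ≤ K ∧ ∀ y ∈ Set.Ico y₁ (stripYT T), ∀ (a b : Fin (2 * T)) (M : ℕ),
      ∑ j ∈ range M, irCoeff T j a b * (stripYT T ^ j - y ^ j) ≤ K * (stripYT T - y) := by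
  have hT1 : 1 ≤ T := by omega
  obtain ⟨y₁, hy₁, c, C, hF⟩ := exists_neumannFamily_Iinf hT (exists_div_sub_le_stripByLim hT1)
  haveI : Nonempty (Fin (2 * T)) := ⟨⟨0, by omega⟩⟩
  refine ⟨y₁, hy₁, C / c ^ 2, hF.K_nonneg, fun y hy a b M => ?_⟩
  have hy' : y ∈ Set.Ico (1 : ℝ) (stripYT T) := ⟨hy₁.1.trans hy.1, hy.2⟩
  -- the bound for every `y' ∈ [y, y_T)`, then `y' ↑ y_T` in the finite sum
  have hbound : ∀ y'' ∈ Set.Ico y (stripYT T),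
      ∑ j ∈ range M, irCoeff T j a b * (y'' ^ j - y ^ j) ≤ C / c ^ 2 * (stripYT T - y) := fun y'' hy'' =>
    (sum_irCoeff_mul_pow_sub_le hT1 hy' ⟨hy'.1.trans hy''.1, hy''.2⟩ hy''.1 a b M).trans
      (hF.sub_le_mul_sub hy ⟨hy.1.trans hy''.1, hy''.2⟩ hy''.1 a b)
  have hcont : Tendsto (fun y'' : ℝ => ∑ j ∈ range M, irCoeff T j a b * (y'' ^ j - y ^ j)) (𝓝[<] stripYT T)
      (𝓝 (∑ j ∈ range M, irCoeff T j a b * (stripYT T ^ j - y ^ j))) := by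
    refine tendsto_nhdsWithin_of_tendsto_nhds (tendsto_finsetSum _ fun j _ => ?_)
    exact ((continuous_pow j).tendsto _).sub_const _ |>.const_mul _
  exact le_of_tendsto hcont (by filter_upwards [Ico_mem_nhdsLT hy.2] with y'' hy'' using hbound y'' hy'')

/-- ★★★ **The coefficient series converges AT the threshold**: `Σ_j m_{ab}(j) y_T^j < ∞` (`2 ≤ T`).
[cite: Seneta1973, §6.2 Theorem 6.3 (the matrix at the convergence parameter is finite); DuminilCopinHammond2013, §2.2; BeatonBousquetMelouDeGierDuminilCopinGuttmann2014, Corollary 8; lane «pcv-sawmu» a-p2 g19] -/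
theorem summable_irCoeff_mul_pow_stripYT (hT : 2 ≤ T) (a b : Fin (2 * T)) :
    Summable fun j => irCoeff T j a b * stripYT T ^ j := by
  have hT1 : 1 ≤ T := by omega
  obtain ⟨y₁, hy₁, K, hK, hb⟩ := exists_sum_irCoeff_stripYT_sub_le hT
  have hYT0 : 0 ≤ stripYT T := (stripYT_pos hT1).le
  refine summable_of_sum_range_le (c := Iinf T y₁ a b + K * (stripYT T - y₁))
    (fun j => mul_nonneg (irCoeff_nonneg hT1 j a b) (pow_nonneg hYT0 _)) fun M => ?_
  have h1 := hb y₁ ⟨le_rfl, hy₁.2⟩ a b M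
  have h2 := sum_range_irCoeff_mul_pow_le hT1 hy₁ a b M
  have hsplit : ∑ j ∈ range M, irCoeff T j a b * stripYT T ^ j =
      ∑ j ∈ range M, irCoeff T j a b * y₁ ^ j + ∑ j ∈ range M, irCoeff T j a b * (stripYT T ^ j - y₁ ^ j) := by
    rw [← sum_add_distrib]; exact sum_congr rfl fun j _ => by ring
  rw [hsplit]; linarith

/-- `0 ≤ Σ_j m_{ab}(j) y_T^j − I(y)_{ab} ≤ K (y_T − y)` near the threshold (plumbing for the limit).
[cite: Seneta1973, §6.2; lane plumbing] -/
theorem exists_tsum_irCoeff_stripYT_sub_Iinf_le (hT : 2 ≤ T) :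
    ∃ y₁ ∈ Set.Ico (1 : ℝ) (stripYT T), ∃ K : ℝ, 0 ≤ K ∧ ∀ y ∈ Set.Ico y₁ (stripYT T), ∀ a b : Fin (2 * T),
      0 ≤ ∑' j, irCoeff T j a b * stripYT T ^ j - Iinf T y a b ∧
        ∑' j, irCoeff T j a b * stripYT T ^ j - Iinf T y a b ≤ K * (stripYT T - y) := by
  have hT1 : 1 ≤ T := by omega
  obtain ⟨y₁, hy₁, K, hK, hb⟩ := exists_sum_irCoeff_stripYT_sub_le hT
  refine ⟨y₁, hy₁, K, hK, fun y hy a b => ?_⟩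
  have hy' : y ∈ Set.Ico (1 : ℝ) (stripYT T) := ⟨hy₁.1.trans hy.1, hy.2⟩
  have hy0 : 0 ≤ y := zero_le_one.trans hy'.1
  have hsT := summable_irCoeff_mul_pow_stripYT hT a b
  have hsy := summable_irCoeff_mul_pow hT1 hy' a b
  have hnn : ∀ j, 0 ≤ irCoeff T j a b * (stripYT T ^ j - y ^ j) := fun j =>
    mul_nonneg (irCoeff_nonneg hT1 j a b) (sub_nonneg.2 (pow_le_pow_left₀ hy0 hy.2.le j))
  have hsd : Summable fun j => irCoeff T j a b * (stripYT T ^ j - y ^ j) := by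
    have : (fun j => irCoeff T j a b * (stripYT T ^ j - y ^ j)) =
        fun j => irCoeff T j a b * stripYT T ^ j - irCoeff T j a b * y ^ j := by funext j; ring
    rw [this]; exact hsT.sub hsy
  have heq : ∑' j, irCoeff T j a b * stripYT T ^ j - Iinf T y a b = ∑' j, irCoeff T j a b * (stripYT T ^ j - y ^ j) := by
    rw [Iinf_eq_tsum_irCoeff hT1 hy', ← hsT.tsum_sub hsy]; exact tsum_congr fun j => by ring
  rw [heq]
  exact ⟨tsum_nonneg hnn, hsd.tsum_le_of_sum_range_le (hb y hy a b)⟩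

/-- ★★★ **`I(y)_{ab} → Σ_j m_{ab}(j) y_T^j` as `y ↑ y_T`** (`2 ≤ T`): the limit kernel of the residue theorem
(`exists_tendsto_bridgeKernel_residue`) is the kernel of irreducible bridges AT the threshold, `I_T = I(y_T)` entrywise.
[cite: Seneta1973, §6.2 Theorem 6.3; DuminilCopinHammond2013, §2.2; BeatonBousquetMelouDeGierDuminilCopinGuttmann2014, Corollary 8; lane «pcv-sawmu» a-p2 g19] -/
theorem tendsto_Iinf_tsum_irCoeff_stripYT (hT : 2 ≤ T) (a b : Fin (2 * T)) :
    Tendsto (fun y => Iinf T y a b) (𝓝[<] stripYT T) (𝓝 (∑' j, irCoeff T j a b * stripYT T ^ j)) := by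
  obtain ⟨y₁, hy₁, K, hK, hb⟩ := exists_tsum_irCoeff_stripYT_sub_Iinf_le hT
  set L := ∑' j, irCoeff T j a b * stripYT T ^ j
  have hlow : Tendsto (fun y : ℝ => L - K * (stripYT T - y)) (𝓝[<] stripYT T) (𝓝 L) := by
    have : Tendsto (fun y : ℝ => L - K * (stripYT T - y)) (𝓝 (stripYT T)) (𝓝 (L - K * (stripYT T - stripYT T))) :=
      tendsto_const_nhds.sub ((tendsto_const_nhds.sub tendsto_id).const_mul K)
    rw [sub_self, mul_zero, sub_zero] at this
    exact tendsto_nhdsWithin_of_tendsto_nhds this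
  refine tendsto_of_tendsto_of_tendsto_of_le_of_le' hlow tendsto_const_nhds ?_ ?_
  · filter_upwards [Ico_mem_nhdsLT hy₁.2] with y hy; linarith [(hb y hy a b).2]
  · filter_upwards [Ico_mem_nhdsLT hy₁.2] with y hy; linarith [(hb y hy a b).1]

/-- Corollary: ANY entrywise left limit of the kernel at `y_T` (in particular the `I_T` of `exists_tendsto_bridgeKernel_residue`)
equals the coefficient series at `y_T`. [cite: Seneta1973, §6.2; lane plumbing] -/
theorem eq_tsum_irCoeff_of_tendsto_Iinf (hT : 2 ≤ T) {a b : Fin (2 * T)} {v : ℝ}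
    (hv : Tendsto (fun y => Iinf T y a b) (𝓝[<] stripYT T) (𝓝 v)) : v = ∑' j, irCoeff T j a b * stripYT T ^ j :=
  tendsto_nhds_unique hv (tendsto_Iinf_tsum_irCoeff_stripYT hT a b)

/-- ★★★ **FINITE MEAN CONTACT NUMBER OF CRITICAL IRREDUCIBLE BRIDGES.** For every width `T ≥ 2` there is `K` with
`Σ_j j · m_{ab}(j) · y_T^{j−1} ≤ K` (summable) for all levels `a, b`: weighting each irreducible standard horizontal bridge of the
strip by `x_c^{length} y_T^{#contacts}`, the expected number of surface contacts is finite — the derivative of the kernel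
`I(y)_{ab}` stays bounded up to its critical point `y_T`.  This is the «finite mean renewal time» of the strip's renewal structure;
in print only the Perron–Frobenius/rationality route would give it.
[cite: Seneta1973, §6.2 Theorem 6.3 (R-positivity: finite derivative at the convergence parameter); DuminilCopinHammond2013, §2.2 (irreducible bridges, renewal); BeatonBousquetMelouDeGierDuminilCopinGuttmann2014, Corollary 8 (arXiv v5 p. 12); lane «pcv-sawmu» a-p2 g19 — own result] -/
theorem exists_tsum_mul_irCoeff_mul_pow_le (hT : 2 ≤ T) :
    ∃ K : ℝ, ∀ a b : Fin (2 * T), (Summable fun j : ℕ => (j : ℝ) * irCoeff T j a b * stripYT T ^ (j - 1)) ∧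
      ∑' j : ℕ, (j : ℝ) * irCoeff T j a b * stripYT T ^ (j - 1) ≤ K := by
  have hT1 : 1 ≤ T := by omega
  obtain ⟨y₁, hy₁, K, hK, hb⟩ := exists_sum_irCoeff_stripYT_sub_le hT
  have hYT0 : 0 ≤ stripYT T := (stripYT_pos hT1).le
  have hnn : ∀ (a b : Fin (2 * T)) (j : ℕ), 0 ≤ (j : ℝ) * irCoeff T j a b * stripYT T ^ (j - 1) := fun a b j =>
    mul_nonneg (mul_nonneg (Nat.cast_nonneg _) (irCoeff_nonneg hT1 j a b)) (pow_nonneg hYT0 _)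
  -- finite sums below `y_T`: `Σ_{j<M} j m_j y^{j-1} ≤ K`
  have hfin : ∀ (a b : Fin (2 * T)) (M : ℕ), ∀ y ∈ Set.Ico y₁ (stripYT T),
      ∑ j ∈ range M, (j : ℝ) * irCoeff T j a b * y ^ (j - 1) ≤ K := fun a b M y hy => by
    have hy0 : 0 ≤ y := zero_le_one.trans (hy₁.1.trans hy.1)
    have hpos : 0 < stripYT T - y := sub_pos.2 hy.2
    have h1 : (∑ j ∈ range M, (j : ℝ) * irCoeff T j a b * y ^ (j - 1)) * (stripYT T - y) ≤ K * (stripYT T - y) := by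
      rw [sum_mul]
      refine (sum_le_sum fun j _ => ?_).trans (hb y hy a b M)
      calc (j : ℝ) * irCoeff T j a b * y ^ (j - 1) * (stripYT T - y)
          = irCoeff T j a b * ((j : ℝ) * y ^ (j - 1) * (stripYT T - y)) := by ring
        _ ≤ irCoeff T j a b * (stripYT T ^ j - y ^ j) :=
          mul_le_mul_of_nonneg_left (mul_pow_mul_sub_le_pow_sub hy0 hy.2.le j) (irCoeff_nonneg hT1 j a b)
    exact le_of_mul_le_mul_right h1 hpos
  -- `y ↑ y_T` in each finite sum
  have hfinT : ∀ (a b : Fin (2 * T)) (M : ℕ), ∑ j ∈ range M, (j : ℝ) * irCoeff T j a b * stripYT T ^ (j - 1) ≤ K :=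
    fun a b M => by
    have hcont : Tendsto (fun y : ℝ => ∑ j ∈ range M, (j : ℝ) * irCoeff T j a b * y ^ (j - 1)) (𝓝[<] stripYT T)
        (𝓝 (∑ j ∈ range M, (j : ℝ) * irCoeff T j a b * stripYT T ^ (j - 1))) :=
      tendsto_nhdsWithin_of_tendsto_nhds (tendsto_finsetSum _ fun j _ => ((continuous_pow (j - 1)).tendsto _).const_mul _)
    exact le_of_tendsto hcont (by filter_upwards [Ico_mem_nhdsLT hy₁.2] with y hy using hfin a b M y hy)
  refine ⟨K, fun a b => ?_⟩
  have hs : Summable fun j : ℕ => (j : ℝ) * irCoeff T j a b * stripYT T ^ (j - 1) :=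
    summable_of_sum_range_le (hnn a b) (hfinT a b)
  exact ⟨hs, hs.tsum_le_of_sum_range_le (hfinT a b)⟩

/-! ### §4 The same facts over tree notions only: Lipschitz bound and linear rate of the kernel at the threshold -/

/-- ★★ **The irreducible-bridge kernel is Lipschitz up to its critical point** (tree notions only, `2 ≤ T`): there are `K ≥ 0` and
`y₁ < y_T` with `I(y')_{ab} − I(y)_{ab} ≤ K (y' − y)` for all `y₁ ≤ y ≤ y' < y_T` and all levels — the endpoint-Lipschitz bound of
the tree's `NeumannFamily.sub_le_mul_sub` for the family `exists_neumannFamily_Iinf`; it is the analytic content of the finite mean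
contact number. [cite: Seneta1973, §6.2 Theorem 6.3; DuminilCopinHammond2013, §2.2; BeatonBousquetMelouDeGierDuminilCopinGuttmann2014, Corollary 8; lane «pcv-sawmu» a-p2 g19] -/
theorem exists_Iinf_sub_Iinf_le_mul (hT : 2 ≤ T) :
    ∃ K : ℝ, ∃ y₁ ∈ Set.Ico (1 : ℝ) (stripYT T), 0 ≤ K ∧ ∀ y ∈ Set.Ico y₁ (stripYT T), ∀ y' ∈ Set.Ico y (stripYT T),
      ∀ a b : Fin (2 * T), Iinf T y' a b - Iinf T y a b ≤ K * (stripYT T - y) := by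
  have hT1 : 1 ≤ T := by omega
  obtain ⟨y₁, hy₁, c, C, hF⟩ := exists_neumannFamily_Iinf hT (exists_div_sub_le_stripByLim hT1)
  haveI : Nonempty (Fin (2 * T)) := ⟨⟨0, by omega⟩⟩
  exact ⟨C / c ^ 2, y₁, hy₁, hF.K_nonneg, fun y hy y' hy' a b =>
    hF.sub_le_mul_sub hy ⟨hy.1.trans hy'.1, hy'.2⟩ hy'.1 a b⟩

/-- ★★ **The kernel converges at a LINEAR RATE at the threshold** (tree notions only, `2 ≤ T`): there are a limit kernel `I_T`,
`K ≥ 0` and `y₁ < y_T` with `I(y)_{ab} → (I_T)_{ab}` as `y ↑ y_T` and `0 ≤ (I_T)_{ab} − I(y)_{ab} ≤ K (y_T − y)` on `[y₁, y_T)`, for all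
levels `a, b` (`I_T = Σ_j m(j) y_T^j` entrywise, §3). [cite: Seneta1973, §6.2 Theorem 6.3; DuminilCopinHammond2013, §2.2; BeatonBousquetMelouDeGierDuminilCopinGuttmann2014, Corollary 8; lane «pcv-sawmu» a-p2 g19] -/
theorem exists_kernelLimit_sub_Iinf_le (hT : 2 ≤ T) :
    ∃ (IT : Matrix (Fin (2 * T)) (Fin (2 * T)) ℝ) (K : ℝ), ∃ y₁ ∈ Set.Ico (1 : ℝ) (stripYT T), 0 ≤ K ∧
      (∀ a b, Tendsto (fun y => Iinf T y a b) (𝓝[<] stripYT T) (𝓝 (IT a b))) ∧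
      ∀ y ∈ Set.Ico y₁ (stripYT T), ∀ a b, 0 ≤ IT a b - Iinf T y a b ∧ IT a b - Iinf T y a b ≤ K * (stripYT T - y) := by
  obtain ⟨y₁, hy₁, K, hK, hb⟩ := exists_tsum_irCoeff_stripYT_sub_Iinf_le hT
  exact ⟨Matrix.of fun a b => ∑' j, irCoeff T j a b * stripYT T ^ j, K, y₁, hy₁, hK,
    fun a b => by rw [Matrix.of_apply]; exact tendsto_Iinf_tsum_irCoeff_stripYT hT a b,
    fun y hy a b => by rw [Matrix.of_apply]; exact hb y hy a b⟩

end HV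

end Literature.Probability.RandomPlanarGeometry.SAW
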